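import Mathlib.Combinatorics.SimpleGraph.Coloring.Vertex
import Summits.Ventures.DiscreteObjects.UnitDistance.ValuationRingReduction
import Summits.Ventures.DiscreteObjects.UnitDistance.MoserLocalReduction

/-!
# Four-colouring graphs whose edge differences are 2-adic unit steps (cell `pub-namedobj`, target (U), seat udg g10)

Framing (verbatim for the cell): lottery ticket; floor = certified bounds/negative ranges.

The combinatorial step (C) of MOSER-FIELD.md (udg g2), residue-field-free: let `Ω ⊇ ℚ₂` carry `LocalData`
(`MoserLocalReduction`).  If the vertices of a graph `G` carry labels `z : V → Ω` such that along every edge the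
difference `z v − z w` is a UNIT STEP (`unitSteps`), then `G` is `4`-colourable (`colorable_four_of_unitStep_labels`):
re-centre each connected component at a base vertex (the centred label is a sum of unit steps, hence in the unit
ball with residue in the colour set `quartFixed`, which is additively closed and has `≤ 4` elements), and colour by
the residue; adjacent vertices differ by a unit step, whose residue is non-zero.  Nothing here is literature.
-/

noncomputable section

namespace Summit.Ventures.DiscreteObjects.UnitDistance.MoserLocal

open Spectral SimpleGraph

variable {Ω : Type*} [Field Ω] [Algebra ℚ_[2] Ω] [Algebra.IsAlgebraic ℚ_[2] Ω] (D : LocalData Ω)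
variable {V : Type*} {G : SimpleGraph V} (z : V → Ω)

/-- Along a walk all of whose steps are unit steps, the total label difference lies in the unit ball and its
residue is a colour. -/
theorem walk_diff_good (hz : ∀ ⦃v w : V⦄, G.Adj v w → z v - z w ∈ unitSteps D) {x y : V} (p : G.Walk x y) :
    ∃ h : z y - z x ∈ ball ℚ_[2] Ω, resid ℚ_[2] Ω ⟨z y - z x, h⟩ ∈ quartFixed Ω := by
  induction p with
  | @nil x =>
    have h0 : z x - z x ∈ ball ℚ_[2] Ω := by rw [sub_self]; exact (ball ℚ_[2] Ω).zero_mem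
    refine ⟨h0, ?_⟩
    have : (⟨z x - z x, h0⟩ : ball ℚ_[2] Ω) = 0 := Subtype.ext (sub_self _)
    rw [this, map_zero]; exact zero_mem_quartFixed
  | @cons a b c hab p ih =>
    obtain ⟨hbc, hcol⟩ := ih
    have hu : z b - z a ∈ unitSteps D := hz (G.adj_symm hab)
    have hub := unitStep_mem_ball D hu
    have hsum : z c - z a = (z c - z b) + (z b - z a) := by ring
    have hmem : z c - z a ∈ ball ℚ_[2] Ω := by rw [hsum]; exact (ball ℚ_[2] Ω).add_mem hbc hub
    refine ⟨hmem, ?_⟩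
    have : (⟨z c - z a, hmem⟩ : ball ℚ_[2] Ω) = ⟨z c - z b, hbc⟩ + ⟨z b - z a, hub⟩ := Subtype.ext hsum
    rw [this, map_add]
    exact add_mem_quartFixed hcol (mem_quartFixed_of_cube (resid_unitStep_cube D hu))

/-- The centred label of `v` (relative to the base vertex of its component) lies in the unit ball. -/
theorem centred_mem_ball (hz : ∀ ⦃v w : V⦄, G.Adj v w → z v - z w ∈ unitSteps D) (v : V) :
    z v - z (baseVertex G v) ∈ ball ℚ_[2] Ω := by
  obtain ⟨p⟩ := baseVertex_reachable G v
  exact (walk_diff_good D z hz p).1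

/-- The residue of the centred label is a colour. -/
theorem resid_centred_mem (hz : ∀ ⦃v w : V⦄, G.Adj v w → z v - z w ∈ unitSteps D) (v : V) :
    resid ℚ_[2] Ω ⟨z v - z (baseVertex G v), centred_mem_ball D z hz v⟩ ∈ quartFixed Ω := by
  obtain ⟨p⟩ := baseVertex_reachable G v
  obtain ⟨h, hc⟩ := walk_diff_good D z hz p
  exact hc

/-- THEOREM (step (C) of MOSER-FIELD.md, kernel form).  A graph whose vertices are labelled in `Ω` with every edge
difference a unit step is `4`-colourable. -/
theorem colorable_four_of_unitStep_labels (hz : ∀ ⦃v w : V⦄, G.Adj v w → z v - z w ∈ unitSteps D) :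
    G.Colorable 4 := by
  classical
  obtain ⟨F, hF4, hF⟩ := exists_finset_quartFixed (Ω := Ω)
  -- the colouring into the finset `F`
  let c : V → F := fun v => ⟨resid ℚ_[2] Ω ⟨z v - z (baseVertex G v), centred_mem_ball D z hz v⟩,
    hF _ (resid_centred_mem D z hz v)⟩
  have hvalid : ∀ {v w : V}, G.Adj v w → c v ≠ c w := by
    intro v w hvw hcvw
    have hb : baseVertex G w = baseVertex G v := (baseVertex_eq_of_adj hvw).symm
    have heq : resid ℚ_[2] Ω ⟨z v - z (baseVertex G v), centred_mem_ball D z hz v⟩ =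
        resid ℚ_[2] Ω ⟨z w - z (baseVertex G w), centred_mem_ball D z hz w⟩ := by
      have := congrArg Subtype.val hcvw
      exact this
    rw [resid_eq_iff] at heq
    have hdiff : (z v - z (baseVertex G v)) - (z w - z (baseVertex G w)) = z v - z w := by rw [hb]; ring
    have hlt : spN ℚ_[2] (z v - z w) < 1 := by
      have := heq
      simp only at this
      rwa [hdiff] at this
    have hone : spN ℚ_[2] (z v - z w) = 1 := spN_unitStep D (hz hvw)
    rw [hone] at hlt
    exact lt_irrefl _ hlt
  have hC : G.Coloring F := Coloring.mk c hvalid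
  have hcol : G.Colorable (Fintype.card F) := hC.colorable
  exact hcol.mono (by simpa using hF4)

end Summit.Ventures.DiscreteObjects.UnitDistance.MoserLocal
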